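import Literature.NumberTheory.EllipticCurves.WeberGamma2Real
import Literature.NumberTheory.EllipticCurves.KleinJIntegralQExpansion
import HarnessLib

/-!
# Real values of `j`, `E₄` and `η⁸` at points `τ` with `2 Re τ ∈ ℤ`
# (Cox, *Primes of the form x² + ny²*, §12.A: "`γ₂(τ₀)` is the real cube root of `j(τ₀)`")

Topic `NumberTheory/EllipticCurves` (level-one modular forms / complex multiplication),
namespace `Literature.NumberTheory.EllipticCurves.ModularForms`.  Theorems only.

Cox's proof of Thm. 12.2 uses that for `τ₀ = √−m` or `τ₀ = (3 + √−m)/2` the numbers `j(τ₀)`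
and `γ₂(τ₀)` are **real** (p. 261: "`γ₂(τ₀)` is the real cube root of `j(τ₀)`"): the nome
`q = e^{2πiτ}` is real as soon as `2 Re τ ∈ ℤ`, and `q^{1/3} = e^{2πiτ/3}` is real when
`2 Re τ ∈ 3ℤ` — which is the reason for the `3` in `(3 + √−m)/2`.  We prove, from the integral
`q`-expansion of `q·j` (`hasSum_formalXJ`), the Bernoulli `q`-expansion of `E₄` (Mathlib) and the
product `η = q^{1/24}∏(1 − qⁿ)` (Mathlib):

* `qParam_im_eq_zero` — `e^{2πiτ} ∈ ℝ` if `2 Re τ ∈ ℤ`;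
* `kleinJ_im_eq_zero` — **`j(τ) ∈ ℝ` if `2 Re τ ∈ ℤ`** (generalising the tree's `kleinJ_axisPt_im`);
* `E₄_im_eq_zero` — `E₄(τ) ∈ ℝ` if `2 Re τ ∈ ℤ`;
* `eta_pow_eight_im_eq_zero` — **`η(τ)⁸ ∈ ℝ` if `2 Re τ ∈ 3ℤ`**;
* `E₄_div_eta_pow_eight_im_eq_zero` — hence `γ₂(τ) = E₄(τ)/η(τ)⁸ ∈ ℝ` if `2 Re τ ∈ 3ℤ`
  (`τ = iy` or `Re τ = 3/2`: Cox's two normalisations of `τ₀`).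

## References

* D. A. Cox, *Primes of the form x² + ny²*, 2nd ed., 2013, §12.A, proof of Thm. 12.2 (p. 261).
  [Cox2013]
* F. Diamond, J. Shurman, *A First Course in Modular Forms*, GTM 228, 2005, §1.1–1.2
  (`q`-expansions of `E₄`, `Δ`, `j`; `η`). [DiamondShurman2005]
-/

noncomputable section

open UpperHalfPlane hiding I
open Complex ModularForm EisensteinSeries ArithmeticFunction
open scoped Real ModularForm MatrixGroups

namespace Literature.NumberTheory.EllipticCurves.ModularForms

local notation "𝕢" => Function.Periodic.qParam

/-! ### Real nomes -/

/-- `e^w` is real when `Im w ∈ πℤ`. [folklore] -/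
theorem exp_im_eq_zero_of_im_eq {w : ℂ} {k : ℤ} (h : w.im = k * π) : (cexp w).im = 0 := by
  rw [Complex.exp_im, h, Real.sin_int_mul_pi, mul_zero]

/-- **`q = e^{2πiτ}` is real when `2 Re τ ∈ ℤ`** (`q = (−1)^{2Re τ} e^{−2π Im τ}`). [folklore] -/
theorem qParam_im_eq_zero {τ : ℂ} {k : ℤ} (h : 2 * τ.re = k) : (𝕢 1 τ).im = 0 := by
  rw [Function.Periodic.qParam, ofReal_one, div_one]
  apply exp_im_eq_zero_of_im_eq (k := k)
  have : (2 * ↑π * I * τ).im = 2 * π * τ.re := by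
    simp [mul_im, mul_re]
  rw [this]
  linear_combination π * h

/-- A complex number with vanishing imaginary part is the cast of its real part. [folklore] -/
theorem eq_ofReal_re_of_im_eq_zero {z : ℂ} (h : z.im = 0) : z = (z.re : ℂ) :=
  Complex.ext (by simp) (by simp [h])

/-- `e^{2πiτ/3} = (e^{2πiτ/24})⁸` is real when `2 Re τ ∈ 3ℤ`. [folklore] -/
theorem qParam_twentyFour_pow_eight_im_eq_zero {τ : ℂ} {k : ℤ} (h : 2 * τ.re = 3 * k) :
    ((𝕢 24 τ) ^ 8).im = 0 := by
  rw [Function.Periodic.qParam, ← Complex.exp_nat_mul]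
  apply exp_im_eq_zero_of_im_eq (k := k)
  have : ((8 : ℕ) * (2 * ↑π * I * τ / (24 : ℝ))).im = 2 * π * τ.re / 3 := by
    simp [mul_im, mul_re, div_ofNat_im]
    ring
  rw [this]
  linear_combination (π / 3) * h

/-! ### `j(τ)` is real when `2 Re τ ∈ ℤ` -/

/-- **`j(τ) ∈ ℝ` when `2 Re τ ∈ ℤ`**: the `q`-expansion `q·j(τ) = Σ cₙ qⁿ` has integer coefficients
(`hasSum_formalXJ`) and `q` is real and non-zero.  (`τ = iy`: the tree's `kleinJ_axisPt_im`;
`Re τ = ½, ³⁄₂`: the other normalisations of CM points in Cox §12.) [cite: Cox2013, §12.A proof of Thm. 12.2 (p. 261)] -/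
theorem kleinJ_im_eq_zero (τ : ℍ) {k : ℤ} (h : 2 * τ.re = k) : (kleinJ τ).im = 0 := by
  have hs := hasSum_formalXJ τ
  have hq : (𝕢 1 (τ : ℂ)).im = 0 := qParam_im_eq_zero (τ := (τ : ℂ)) (by simpa using h)
  set r : ℝ := (𝕢 1 (τ : ℂ)).re with hr
  have hqr : 𝕢 1 (τ : ℂ) = (r : ℂ) := eq_ofReal_re_of_im_eq_zero hq
  rw [hqr] at hs
  have hr0 : r ≠ 0 := by
    intro h0
    have := Function.Periodic.qParam_ne_zero (h := 1) (τ : ℂ)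
    rw [hqr, h0, ofReal_zero] at this
    exact this rfl
  have him : HasSum (fun n : ℕ ↦ ((((PowerSeries.coeff n formalXJ : ℤ) : ℂ) * (r : ℂ) ^ n)).im)
      (((r : ℂ) * kleinJ τ)).im := Complex.hasSum_im hs
  have h0 : (fun n : ℕ ↦ ((((PowerSeries.coeff n formalXJ : ℤ) : ℂ) * (r : ℂ) ^ n)).im) = 0 := by
    funext n
    rw [show (((PowerSeries.coeff n formalXJ : ℤ) : ℂ) * (r : ℂ) ^ n)
      = (((PowerSeries.coeff n formalXJ : ℤ) * r ^ n : ℝ) : ℂ) by push_cast; ring]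
    exact Complex.ofReal_im _
  rw [h0] at him
  have := him.unique hasSum_zero
  rw [Complex.mul_im, Complex.ofReal_re, Complex.ofReal_im, zero_mul, add_zero] at this
  exact (mul_eq_zero.mp this).resolve_left hr0

/-! ### `E₄(τ)` is real when `2 Re τ ∈ ℤ` -/

/-- **`E₄(τ) ∈ ℝ` when `2 Re τ ∈ ℤ`** (`E₄ = 1 + 240 Σ σ₃(n)qⁿ` with `q` real; Mathlib's
`EisensteinSeries.q_expansion_bernoulli`). [folklore] -/
theorem E₄_im_eq_zero (τ : ℍ) {k : ℤ} (h : 2 * τ.re = k) : (E₄ τ).im = 0 := by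
  have hE := EisensteinSeries.q_expansion_bernoulli (k := 4) (by norm_num) (by decide) τ
  have hq : (cexp (2 * π * I * (τ : ℂ))).im = 0 := by
    have := qParam_im_eq_zero (τ := (τ : ℂ)) (k := k) (by simpa using h)
    simpa [Function.Periodic.qParam] using this
  set r : ℝ := (cexp (2 * π * I * (τ : ℂ))).re with hr
  have hqr : cexp (2 * π * I * (τ : ℂ)) = (r : ℂ) := eq_ofReal_re_of_im_eq_zero hq
  have hval : E₄ τ = ((1 - (2 * 4 / (bernoulli 4 : ℝ)) * ∑' n : ℕ+, (ArithmeticFunction.sigma 3 n : ℝ) * r ^ (n : ℤ) : ℝ) : ℂ) := by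
    change E (by norm_num : 3 ≤ 4) τ = _
    rw [hE, hqr]
    push_cast
    ring
  rw [hval, ofReal_im]

/-! ### `η(τ)⁸` is real when `2 Re τ ∈ 3ℤ` -/

/-- For a real `r` with `|r| < 1` the product `∏ (1 − rⁿ⁺¹)` converges (in `ℝ`). [folklore] -/
theorem multipliable_one_sub_pow_real {r : ℝ} (hr : |r| < 1) :
    Multipliable fun n : ℕ ↦ 1 - r ^ (n + 1) := by
  apply multipliable_one_add_of_summable (f := fun n ↦ -r ^ (n + 1))
  have hs : Summable fun n : ℕ ↦ r ^ (n + 1) :=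
    (summable_nat_add_iff 1).mpr (summable_geometric_of_abs_lt_one hr)
  simpa [abs_pow] using hs.norm

/-- The product `∏ (1 − qⁿ⁺¹)` is real for a real nome `q = e^{2πiτ}`, `2 Re τ ∈ ℤ`. [folklore] -/
theorem eta_tprod_im_eq_zero {τ : ℂ} (hτ : 0 < τ.im) {k : ℤ} (h : 2 * τ.re = k) :
    (∏' n : ℕ, (1 - eta_q n τ)).im = 0 := by
  have hq : (𝕢 1 τ).im = 0 := qParam_im_eq_zero h
  set r : ℝ := (𝕢 1 τ).re with hr
  have hqr : 𝕢 1 τ = (r : ℂ) := eq_ofReal_re_of_im_eq_zero hq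
  have hnorm : ‖𝕢 1 τ‖ < 1 := by simpa using norm_qParam_lt_one 1 ⟨τ, hτ⟩
  have hrabs : |r| < 1 := by
    rw [hqr, Complex.norm_real, Real.norm_eq_abs] at hnorm
    exact hnorm
  have hmult := multipliable_one_sub_pow_real hrabs
  have hprod : ∏' n : ℕ, (1 - eta_q n τ) = ((∏' n : ℕ, (1 - r ^ (n + 1)) : ℝ) : ℂ) := by
    rw [show ((∏' n : ℕ, (1 - r ^ (n + 1)) : ℝ) : ℂ) = Complex.ofRealHom (∏' n : ℕ, (1 - r ^ (n + 1))) from rfl,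
      Multipliable.map_tprod hmult Complex.ofRealHom Complex.continuous_ofReal]
    apply tprod_congr
    intro n
    simp only [eta_q, hqr, Complex.ofRealHom_eq_coe]
    push_cast
    ring
  rw [hprod, ofReal_im]

/-- **`η(τ)⁸ ∈ ℝ` when `2 Re τ ∈ 3ℤ`**: `η⁸ = e^{2πiτ/3} ∏ (1 − qⁿ)⁸` with both factors real
(for `Re τ = ³⁄₂`: `e^{2πiτ/3} = −e^{−2π Im τ/3}`; Cox's normalisation `τ₀ = (3 + √−m)/2`).
[cite: Cox2013, §12.A proof of Thm. 12.2 (p. 261)] -/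
theorem eta_pow_eight_im_eq_zero {τ : ℂ} (hτ : 0 < τ.im) {k : ℤ} (h : 2 * τ.re = 3 * k) :
    (η τ ^ 8).im = 0 := by
  have h1 : ((𝕢 24 τ) ^ 8).im = 0 := qParam_twentyFour_pow_eight_im_eq_zero h
  have h2 : (∏' n : ℕ, (1 - eta_q n τ)).im = 0 :=
    eta_tprod_im_eq_zero hτ (k := 3 * k) (by rw [h]; push_cast; ring)
  rw [ModularForm.eta, mul_pow, eq_ofReal_re_of_im_eq_zero h1,
    eq_ofReal_re_of_im_eq_zero (z := ∏' n : ℕ, (1 - eta_q n τ)) h2]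
  rw [← ofReal_pow, ← ofReal_mul, ofReal_im]

/-- **`γ₂(τ) = E₄(τ)/η(τ)⁸ ∈ ℝ` when `2 Re τ ∈ 3ℤ`** (`τ = iy`, or `Re τ = ³⁄₂` as for
`τ₀ = (3 + √−m)/2`): "`γ₂(τ₀)` is the real cube root of `j(τ₀)`". [cite: Cox2013, §12.A proof of Thm. 12.2 (p. 261)] -/
theorem E₄_div_eta_pow_eight_im_eq_zero (τ : ℍ) {k : ℤ} (h : 2 * τ.re = 3 * k) :
    (E₄ τ / η (τ : ℂ) ^ 8).im = 0 := by
  have hE : (E₄ τ).im = 0 := E₄_im_eq_zero τ (k := 3 * k) (by rw [h]; push_cast; ring)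
  have hη : (η (τ : ℂ) ^ 8).im = 0 := eta_pow_eight_im_eq_zero τ.2 (k := k) (by simpa using h)
  rw [eq_ofReal_re_of_im_eq_zero hE, eq_ofReal_re_of_im_eq_zero hη, ← ofReal_div, ofReal_im]

end Literature.NumberTheory.EllipticCurves.ModularForms

end
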